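import Mathlib
import Summits.Ventures.PercRepro2.A3PendantFreeRootFibres

/-!
# (FM) at a root: BHK 1.4 plus the positive association of `C₁` given `Q`
(blind cell PercRepro2, night-1 g31; proofs/NIGHT1-G31.md §3″)

On the fibres of `C₁ = C(a₁)` (the `a₁`-exploration on `Q = {a₁ ↮ a₂}`) every mark mass is explicit
through `g_x(W) = P(x ∈ C(a₂) in G ∖ W)` (`delClusterProb`): `P(C₁ = W, Q, x ∈ C₁) = 1[x ∈ W] m_W`
and `P(C₁ = W, Q, x ∈ C₂) = g_x(W) m_W` (the tower identity `prob_clusterIn_inter_eq_expect`).  The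
first-order functional at `a₁` is then the cluster covariance

  `FMfun(a₁) = 2 [E(g_b g_o; Q) − E(g_b; Q) E(g_o; Q)/P(Q)] − 2 [P(Q, b ∈ C₁, o ∈ C₂) − P(Q, b ∈ C₁) P(Q, o ∈ C₂)/P(Q)]`

(`FMfun_self_root`), whose first bracket is `≥ 0` by BHK06 Thm 1.3 — `C₁` is positively associated
given `Q`, applied to the increasing functionals `1 − g_b`, `1 − g_o` (`bhk_same_cluster`) — and whose
second bracket is `≤ 0` by BHK 1.4 (`bhk_cross_cluster`): **`FM_self_root`: `0 ≤ FMfun(a₁)`**.  With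
`FM_self_o`, `FM_self_b` (A3PendantFreeMarks) and the root swap, (FM) holds at every mark.  Standard axioms.
-/

namespace Summit.Ventures.PercRepro2

open UnionCluster CovForm PendantRoot PendantO

namespace CovForm

namespace A3Fibre

/-! ## (FM) at `a₁` -/

section AtRoot

variable {V : Type*} {E : Type*} [Fintype V] [DecidableEq V] [Fintype E] [DecidableEq E]
  {R : Type*} [Field R] [LinearOrder R] [IsStrictOrderedRing R]

omit [Fintype V] [DecidableEq V] [Fintype E] [DecidableEq E] [LinearOrder R] [IsStrictOrderedRing R] in
/-- The indicator of `{C(a₁) ∈ 𝓤} ∩ A` is the product of the indicators. -/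
lemma indicator_clusterIn_inter (ends : E → Sym2 V) (a₁ : V) (𝓤 : Set (Set V)) (A : Set (Config E))
    (ω : Config E) :
    (clusterInEvent ends a₁ 𝓤 ∩ A).indicator (1 : Config E → R) ω =
      𝓤.indicator (1 : Set V → R) (cluster ends ω a₁) * A.indicator (1 : Config E → R) ω := by
  by_cases h1 : cluster ends ω a₁ ∈ 𝓤 <;> by_cases h2 : ω ∈ A
  · rw [Set.indicator_of_mem (Set.mem_inter (mem_clusterInEvent.2 h1) h2), Set.indicator_of_mem h1,
      Set.indicator_of_mem h2]
    simp
  · rw [Set.indicator_of_notMem (fun h => h2 h.2), Set.indicator_of_notMem h2, mul_zero]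
  · rw [Set.indicator_of_notMem (fun h => h1 (mem_clusterInEvent.1 h.1)), Set.indicator_of_notMem h1,
      zero_mul]
  · rw [Set.indicator_of_notMem (fun h => h1 (mem_clusterInEvent.1 h.1)), Set.indicator_of_notMem h1,
      zero_mul]

omit [Fintype V] [DecidableEq V] [LinearOrder R] [IsStrictOrderedRing R] in
/-- `P(C(a₁) ∈ 𝓤, a₁ ↮ a₂) = E[1_𝓤(C₁) 1_Q]`. -/
lemma prob_clusterIn_inter_compl_eq_expect (p : E → R) (ends : E → Sym2 V) (a₁ a₂ : V)
    (𝓤 : Set (Set V)) :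
    prob p (clusterInEvent ends a₁ 𝓤 ∩ (connEvent ends a₁ a₂)ᶜ) =
      expect p (fun ω => 𝓤.indicator (1 : Set V → R) (cluster ends ω a₁) *
        ((connEvent ends a₁ a₂)ᶜ).indicator (1 : Config E → R) ω) := by
  rw [prob_eq_expect_indicator]
  congr 1
  funext ω
  exact indicator_clusterIn_inter ends a₁ 𝓤 _ ω

omit [DecidableEq V] [LinearOrder R] [IsStrictOrderedRing R] in
/-- `P(C(a₂) ∈ 𝓥, a₁ ↮ a₂) = E[g_𝓥(C₁) 1_Q]` (the tower identity with `𝓤 = univ`). -/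
lemma prob_clusterIn_right_inter_compl_eq_expect (p : E → R) (ends : E → Sym2 V) (a₁ a₂ : V)
    (𝓥 : Set (Set V)) :
    prob p (clusterInEvent ends a₂ 𝓥 ∩ (connEvent ends a₁ a₂)ᶜ) =
      expect p (fun ω => delClusterProb p ends a₂ 𝓥 (cluster ends ω a₁) *
        ((connEvent ends a₁ a₂)ᶜ).indicator (1 : Config E → R) ω) := by
  have h := prob_clusterIn_inter_eq_expect p ends a₁ a₂ Set.univ 𝓥
  have hu : clusterInEvent ends a₁ (Set.univ : Set (Set V)) = Set.univ := by
    ext ω; simp [clusterInEvent]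
  rw [hu, Set.univ_inter] at h
  simpa only [Set.indicator_univ, Pi.one_apply, one_mul] using h

/-- **`FMfun(a₁)` through the revealed cluster `C₁`**: with `g_x = delClusterProb p ends a₂ {T | x ∈ T}`,
`ι_b = 1_{b ∈ ·}` and `I = 1_{a₁ ↮ a₂}`,
`FMfun(a₁) = 2 [E(g_b g_o I) − E(g_b I) E(g_o I)/P(Q)] − 2 [E(ι_b g_o I) − E(ι_b I) E(g_o I)/P(Q)]`. -/
theorem FMfun_self_root (p : E → R) (ends : E → Sym2 V) (o a₁ a₂ b : V)
    (hQ : prob p (avoidAll ends a₂ {a₁}) ≠ 0) :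
    FMfun p ends o a₁ a₂ a₁ b =
      2 * (expect p (fun ω => delClusterProb p ends a₂ {T : Set V | b ∈ T} (cluster ends ω a₁) *
              delClusterProb p ends a₂ {T : Set V | o ∈ T} (cluster ends ω a₁) *
              ((connEvent ends a₁ a₂)ᶜ).indicator (1 : Config E → R) ω) -
            expect p (fun ω => delClusterProb p ends a₂ {T : Set V | b ∈ T} (cluster ends ω a₁) *
              ((connEvent ends a₁ a₂)ᶜ).indicator (1 : Config E → R) ω) *
            expect p (fun ω => delClusterProb p ends a₂ {T : Set V | o ∈ T} (cluster ends ω a₁) *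
              ((connEvent ends a₁ a₂)ᶜ).indicator (1 : Config E → R) ω) /
            prob p (connEvent ends a₁ a₂)ᶜ) -
        2 * (expect p (fun ω => ({T : Set V | b ∈ T} : Set (Set V)).indicator (1 : Set V → R)
                (cluster ends ω a₁) *
              delClusterProb p ends a₂ {T : Set V | o ∈ T} (cluster ends ω a₁) *
              ((connEvent ends a₁ a₂)ᶜ).indicator (1 : Config E → R) ω) -
            expect p (fun ω => ({T : Set V | b ∈ T} : Set (Set V)).indicator (1 : Set V → R)
                (cluster ends ω a₁) *
              ((connEvent ends a₁ a₂)ᶜ).indicator (1 : Config E → R) ω) *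
            expect p (fun ω => delClusterProb p ends a₂ {T : Set V | o ∈ T} (cluster ends ω a₁) *
              ((connEvent ends a₁ a₂)ᶜ).indicator (1 : Config E → R) ω) /
            prob p (connEvent ends a₁ a₂)ᶜ) := by
  -- the `A`-sums vanish: the fibres of `a₁` off `a₁` are empty
  have hA0 : ∀ x, ∑ W ∈ fibresA a₁ a₂, Su p ends a₁ a₂ a₁ x W = 0 := fun x =>
    Finset.sum_eq_zero fun W hW =>
      Su_eq_zero_of_notMem_self p ends a₁ a₂ a₁ x (Finset.mem_filter.1 hW).2.1
  have hA1 : ∑ W ∈ fibresA a₁ a₂,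
      Su p ends a₁ a₂ a₁ b W * Su p ends a₁ a₂ a₁ o W / mW p ends a₁ a₂ a₁ W = 0 :=
    Finset.sum_eq_zero fun W hW => by
      rw [Su_eq_zero_of_notMem_self p ends a₁ a₂ a₁ b (Finset.mem_filter.1 hW).2.1]
      ring
  have hD : prob p (PDEvent ends a₁ a₂ a₁) = 0 := by
    rw [prob_PD_eq_fibresA]
    exact Finset.sum_eq_zero fun W hW =>
      mW_eq_zero_of_notMem_self p ends a₁ a₂ a₁ (Finset.mem_filter.1 hW).2.1
  unfold FMfun gamma0
  rw [hA0, hA0, hA1, hD]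
  -- the three fibre sums as cluster expectations
  set γ₀ := LeafStep.mU p ends a₁ a₂ o / prob p (avoidAll ends a₂ {a₁}) with hγ₀
  have s1 := sum_mW_root_mul p ends a₁ a₂ (fun S =>
    (({T : Set V | b ∈ T} : Set (Set V)).indicator (1 : Set V → R) S -
        delClusterProb p ends a₂ {T : Set V | b ∈ T} S) *
      (γ₀ - 2 * delClusterProb p ends a₂ {T : Set V | o ∈ T} S))
  have s2 := sum_mW_root_mul p ends a₁ a₂ (fun S =>
    ({T : Set V | b ∈ T} : Set (Set V)).indicator (1 : Set V → R) S -
      delClusterProb p ends a₂ {T : Set V | b ∈ T} S)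
  have s3' := sum_mW_root_mul p ends a₁ a₂ (fun S =>
    γ₀ - 2 * delClusterProb p ends a₂ {T : Set V | o ∈ T} S)
  beta_reduce at s1 s2 s3'
  rw [Finset.sum_congr rfl (fun W _ => term_root p ends o a₁ a₂ b γ₀ W), s1,
    Finset.sum_congr rfl (fun W _ => Ssig_root p ends a₁ a₂ b W), s2,
    Finset.sum_congr rfl (fun W _ => SFg_root p ends o a₁ a₂ γ₀ W), s3']
  rw [PendantRoot.avoidAll_eq_compl ends a₁ a₂] at hQ ⊢
  -- linearity
  set I : Config E → R := ((connEvent ends a₁ a₂)ᶜ).indicator 1 with hI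
  set gb : Set V → R := delClusterProb p ends a₂ {T : Set V | b ∈ T} with hgb
  set go : Set V → R := delClusterProb p ends a₂ {T : Set V | o ∈ T} with hgo
  set ib : Set V → R := ({T : Set V | b ∈ T} : Set (Set V)).indicator 1 with hib
  have hQI : expect p I = prob p (connEvent ends a₁ a₂)ᶜ := (prob_eq_expect_indicator p _).symm
  have e1 : (fun ω => I ω * ((ib (cluster ends ω a₁) - gb (cluster ends ω a₁)) *
      (γ₀ - 2 * go (cluster ends ω a₁)))) =
      (fun ω => γ₀ * (ib (cluster ends ω a₁) * I ω)) -
        (fun ω => 2 * (ib (cluster ends ω a₁) * go (cluster ends ω a₁) * I ω)) -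
        (fun ω => γ₀ * (gb (cluster ends ω a₁) * I ω)) +
        (fun ω => 2 * (gb (cluster ends ω a₁) * go (cluster ends ω a₁) * I ω)) := by
    funext ω
    simp only [Pi.add_apply, Pi.sub_apply]
    ring
  have e2 : (fun ω => I ω * (ib (cluster ends ω a₁) - gb (cluster ends ω a₁))) =
      (fun ω => ib (cluster ends ω a₁) * I ω) - (fun ω => gb (cluster ends ω a₁) * I ω) := by
    funext ω
    simp only [Pi.sub_apply]
    ring
  have e3 : (fun ω => I ω * (γ₀ - 2 * go (cluster ends ω a₁))) =
      (fun ω => γ₀ * I ω) - (fun ω => 2 * (go (cluster ends ω a₁) * I ω)) := by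
    funext ω
    simp only [Pi.sub_apply]
    ring
  rw [e1, e2, e3, expect_add, expect_sub, expect_sub, expect_sub, expect_sub, expect_const_mul,
    expect_const_mul, expect_const_mul, expect_const_mul, expect_const_mul, expect_const_mul, hQI]
  field_simp
  ring

/-- **(FM) holds at `a₁`**: BHK 1.4 for `(b ∈ C₁, o ∈ C₂)` and the positive association of `C₁`
given `a₁ ↮ a₂` (`bhk_same_cluster`, BHK06 Thm 1.3) for the antitone `g_b, g_o`. -/
theorem FM_self_root {p : E → R} (hp : IsProbVec p) (ends : E → Sym2 V) (o a₁ a₂ b : V) :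
    0 ≤ FMfun p ends o a₁ a₂ a₁ b := by
  rcases eq_or_ne (prob p (avoidAll ends a₂ {a₁})) 0 with hQ | hQ
  · have hz : ∀ W : Finset V, mW p ends a₁ a₂ a₁ W = 0 := fun W =>
      le_antisymm (hQ ▸ prob_mono hp (Set.inter_subset_left : fibre ends a₁ a₂ a₁ W ⊆ _))
        (prob_nonneg hp _)
    have hS : ∀ W : Finset V, Ssig p ends a₁ a₂ a₁ b W = 0 := fun W =>
      Ssig_eq_zero_of_mW_eq_zero hp ends a₁ a₂ a₁ b W (hz W)
    have hU : ∀ W : Finset V, Su p ends a₁ a₂ a₁ b W = 0 := fun W =>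
      Su_eq_zero_of_mW_eq_zero hp ends a₁ a₂ a₁ b W (hz W)
    have hUo : ∀ W : Finset V, Su p ends a₁ a₂ a₁ o W = 0 := fun W =>
      Su_eq_zero_of_mW_eq_zero hp ends a₁ a₂ a₁ o W (hz W)
    unfold FMfun
    simp [hS, hU, hUo, hz, hQ]
  · rw [FMfun_self_root p ends o a₁ a₂ b hQ]
    rw [PendantRoot.avoidAll_eq_compl ends a₁ a₂] at hQ
    have hQpos : 0 < prob p (connEvent ends a₁ a₂)ᶜ :=
      lt_of_le_of_ne (prob_nonneg hp _) (Ne.symm hQ)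
    set I : Config E → R := ((connEvent ends a₁ a₂)ᶜ).indicator 1 with hI
    set gb : Set V → R := delClusterProb p ends a₂ {T : Set V | b ∈ T} with hgb
    set go : Set V → R := delClusterProb p ends a₂ {T : Set V | o ∈ T} with hgo
    set ib : Set V → R := ({T : Set V | b ∈ T} : Set (Set V)).indicator 1 with hib
    set Gbo := expect p (fun ω => gb (cluster ends ω a₁) * go (cluster ends ω a₁) * I ω) with hGbo
    set Gb := expect p (fun ω => gb (cluster ends ω a₁) * I ω) with hGb
    set Go := expect p (fun ω => go (cluster ends ω a₁) * I ω) with hGo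
    set Ebo := expect p (fun ω => ib (cluster ends ω a₁) * go (cluster ends ω a₁) * I ω) with hEbo
    set Eb := expect p (fun ω => ib (cluster ends ω a₁) * I ω) with hEb
    set Q := prob p (connEvent ends a₁ a₂)ᶜ with hQdef
    -- positive association of `C₁` given `Q`: `Gb · Go ≤ Q · Gbo`
    have hPA : Gb * Go ≤ Q * Gbo := by
      have hanti_b : Antitone gb := delClusterProb_anti p hp ends a₂ (isUpperSet_mem_setOf b)
      have hanti_o : Antitone go := delClusterProb_anti p hp ends a₂ (isUpperSet_mem_setOf o)
      have h := bhk_same_cluster p hp ends a₁ a₂ (F₁ := fun S => 1 - gb S) (F₂ := fun S => 1 - go S)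
        (fun S S' hSS' => sub_le_sub_left (hanti_b hSS') 1)
        (fun S S' hSS' => sub_le_sub_left (hanti_o hSS') 1)
        (fun S => sub_nonneg.2 (delClusterProb_le_one p hp ends a₂ _ S))
        (fun S => sub_nonneg.2 (delClusterProb_le_one p hp ends a₂ _ S))
      have hQI : expect p I = Q := (prob_eq_expect_indicator p _).symm
      have f1 : (fun ω => (1 - gb (cluster ends ω a₁)) * I ω) =
          I - (fun ω => gb (cluster ends ω a₁) * I ω) := by
        funext ω; simp only [Pi.sub_apply]; ring
      have f2 : (fun ω => (1 - go (cluster ends ω a₁)) * I ω) =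
          I - (fun ω => go (cluster ends ω a₁) * I ω) := by
        funext ω; simp only [Pi.sub_apply]; ring
      have f3 : (fun ω => (1 - gb (cluster ends ω a₁)) * (1 - go (cluster ends ω a₁)) * I ω) =
          I - (fun ω => gb (cluster ends ω a₁) * I ω) - (fun ω => go (cluster ends ω a₁) * I ω) +
            (fun ω => gb (cluster ends ω a₁) * go (cluster ends ω a₁) * I ω) := by
        funext ω; simp only [Pi.sub_apply, Pi.add_apply]; ring
      rw [f1, f2, f3, expect_sub, expect_sub, expect_add, expect_sub, expect_sub, hQI] at h
      nlinarith [h]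
    -- BHK 1.4: `Q · Ebo ≤ Eb · Go`
    have hBHK : Ebo * Q ≤ Eb * Go := by
      have h := bhk_cross_cluster p hp ends a₁ a₂ (isUpperSet_mem_setOf b) (isUpperSet_mem_setOf o)
      rw [prob_clusterIn_inter_eq_expect, prob_clusterIn_inter_compl_eq_expect,
        prob_clusterIn_right_inter_compl_eq_expect] at h
      exact h
    have h1 : 0 ≤ Gbo - Gb * Go / Q := by
      rw [sub_nonneg, div_le_iff₀ hQpos]
      linarith
    have h2 : Ebo - Eb * Go / Q ≤ 0 := by
      rw [sub_nonpos, le_div_iff₀ hQpos]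
      linarith
    linarith

end AtRoot

/-! ## The root swap, and (FM) at `a₂` -/

section Swap

variable {V : Type*} {E : Type*} [Fintype V] [DecidableEq V] [Fintype E] [DecidableEq E]
  {R : Type*} [Field R] [LinearOrder R] [IsStrictOrderedRing R]

omit [Fintype V] [LinearOrder R] [IsStrictOrderedRing R] in
/-- `SFg` at a fixed centring changes sign under the root swap. -/
lemma SFg_swap (p : E → R) (ends : E → Sym2 V) (o a₁ a₂ v : V) (γ : R) (W : Finset V) :
    RootEdge.SFg p ends o a₂ a₁ v γ W = -RootEdge.SFg p ends o a₁ a₂ v γ W := by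
  by_cases h : a₁ ∈ W ∧ a₂ ∈ W
  · obtain ⟨hm, hs, hu⟩ := masses_eq_zero_of_mem_mem p ends a₁ a₂ v o h.1 h.2
    obtain ⟨hm', hs', hu'⟩ := masses_eq_zero_of_mem_mem p ends a₂ a₁ v o h.2 h.1
    simp [RootEdge.SFg, hm, hs, hu, hm', hs', hu']
  · unfold RootEdge.SFg
    rw [Ssig_swap, s3_swap_of_not_both h, mW_swap, Su_swap]
    ring

omit [Fintype V] [DecidableEq V] [LinearOrder R] [IsStrictOrderedRing R] in
/-- `m_x` is symmetric in the roots. -/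
lemma mU_swap (p : E → R) (ends : E → Sym2 V) (a₁ a₂ x : V) :
    LeafStep.mU p ends a₂ a₁ x = LeafStep.mU p ends a₁ a₂ x := by
  unfold LeafStep.mU
  rw [avoidAll_symm ends a₁ a₂, add_comm]

omit [Fintype V] [DecidableEq V] [LinearOrder R] [IsStrictOrderedRing R] in
/-- `γ₀` is symmetric in the roots. -/
lemma gamma0_swap (p : E → R) (ends : E → Sym2 V) (o a₁ a₂ : V) :
    gamma0 p ends o a₂ a₁ = gamma0 p ends o a₁ a₂ := by
  unfold gamma0
  rw [mU_swap, avoidAll_symm ends a₁ a₂]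

omit [LinearOrder R] [IsStrictOrderedRing R] in
/-- **(FM) is symmetric in the two roots.** -/
theorem FMfun_swap (p : E → R) (ends : E → Sym2 V) (o a₁ a₂ v b : V) :
    FMfun p ends o a₂ a₁ v b = FMfun p ends o a₁ a₂ v b := by
  unfold FMfun
  rw [fibresA_swap, PDEvent_swap, avoidAll_symm ends a₁ a₂, gamma0_swap, mU_swap p ends a₁ a₂ o,
    mU_swap p ends a₁ a₂ b]
  simp only [Ssig_swap p ends a₁ a₂ v b, SFg_swap p ends o a₁ a₂ v, mW_swap p ends a₁ a₂ v,
    Su_swap p ends a₁ a₂ v b, Su_swap p ends a₁ a₂ v o, Finset.sum_neg_distrib, neg_mul, mul_neg,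
    neg_neg]

/-- **(FM) holds at `a₂`** (the root swap of `FM_self_root`). -/
theorem FM_self_root₂ {p : E → R} (hp : IsProbVec p) (ends : E → Sym2 V) (o a₁ a₂ b : V) :
    0 ≤ FMfun p ends o a₁ a₂ a₂ b := by
  rw [← FMfun_swap]
  exact FM_self_root hp ends o a₂ a₁ b

end Swap

end A3Fibre

end CovForm

end Summit.Ventures.PercRepro2
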